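import Mathlib.Analysis.Calculus.ContDiff.Deriv
import Mathlib.Analysis.Calculus.Deriv.Comp
import Mathlib.Analysis.Calculus.Deriv.Mul
import Mathlib.Analysis.Calculus.Deriv.Add
import Mathlib.Analysis.Calculus.ContDiff.Basic
import HarnessLib

/-!
# Second and third derivatives of a function along a curve (Faà di Bruno to order three)

Topic `Literature/Analysis/Calculus`.  For a curve `γ : ℝ → E` and a map `F : E → G`, both `C³`
on open sets `I ∋ s` and `U ⊇ γ(I)`,

  `(F ∘ γ)'  = DF(γ)(γ')`,
  `(F ∘ γ)'' = D²F(γ)(γ', γ') + DF(γ)(γ'')`,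
  `(F ∘ γ)''' = D³F(γ)(γ', γ', γ') + D²F(γ)(γ'', γ') + 2 D²F(γ)(γ', γ'') + DF(γ)(γ''')`

(`deriv_comp_curve`, `deriv_deriv_comp_curve`, `deriv_deriv_deriv_comp_curve`; with the
symmetry of `D²F` the middle terms are `3 D²F(γ)(γ'', γ')`, `deriv_deriv_deriv_comp_curve_symm`).
This is the one-variable Faà di Bruno formula to order three (e.g. L. Comtet, *Advanced
Combinatorics* (1974), §3.4; here simply three product rules), recorded because third-order
quantities along curves — the cubic term of a cusp, `∂³h/∂x³` after a splitting — are computed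
and shown coordinate-independent through it.  Everything is proved; no named fact.

## References

* L. Comtet, *Advanced Combinatorics* (1974), §3.4, Thm. A (Faà di Bruno). [folklore]
-/

noncomputable section

-- the third derivative lives in the nested space `E →L[ℝ] E →L[ℝ] G`
set_option maxSynthPendingDepth 2

open Set Function Filter
open scoped Topology ContDiff

namespace Literature.Analysis.Calculus

section

variable {E G : Type*} [NormedAddCommGroup E] [NormedSpace ℝ E] [NormedAddCommGroup G]
  [NormedSpace ℝ G]

/-- **First derivative along a curve**: `(F ∘ γ)'(s) = DF(γ s)(γ'(s))` on `I`. [folklore] -/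
theorem hasDerivAt_comp_curve {F : E → G} {γ : ℝ → E} {I : Set ℝ} {U : Set E} (hI : IsOpen I)
    (hU : IsOpen U) {n : WithTop ℕ∞} (hn : 1 ≤ n) (hF : ContDiffOn ℝ n F U)
    (hγ : ContDiffOn ℝ n γ I) (hmaps : MapsTo γ I U) {s : ℝ} (hs : s ∈ I) :
    HasDerivAt (F ∘ γ) (fderiv ℝ F (γ s) (deriv γ s)) s := by
  have hγd : HasDerivAt γ (deriv γ s) s :=
    ((hγ.contDiffAt (hI.mem_nhds hs)).differentiableAt (zero_lt_one.trans_le hn).ne').hasDerivAt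
  have hFd : HasFDerivAt F (fderiv ℝ F (γ s)) (γ s) :=
    ((hF.contDiffAt (hU.mem_nhds (hmaps hs))).differentiableAt
      (zero_lt_one.trans_le hn).ne').hasFDerivAt
  exact hFd.comp_hasDerivAt s hγd

/-- `(F ∘ γ)' = DF(γ)(γ')` as functions on `I`. [folklore] -/
theorem deriv_comp_curve {F : E → G} {γ : ℝ → E} {I : Set ℝ} {U : Set E} (hI : IsOpen I)
    (hU : IsOpen U) {n : WithTop ℕ∞} (hn : 1 ≤ n) (hF : ContDiffOn ℝ n F U)
    (hγ : ContDiffOn ℝ n γ I) (hmaps : MapsTo γ I U) :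
    EqOn (deriv (F ∘ γ)) (fun s => fderiv ℝ F (γ s) (deriv γ s)) I := fun _ hs =>
  (hasDerivAt_comp_curve hI hU hn hF hγ hmaps hs).deriv

/-- **Second derivative along a curve**, pointwise `HasDerivAt` form:
`(s ↦ DF(γ s)(γ' s))' = D²F(γ)(γ')(γ') + DF(γ)(γ'')` on `I` (`n ≥ 2`). [folklore] -/
theorem hasDerivAt_fderiv_comp_curve_apply_deriv {F : E → G} {γ : ℝ → E} {I : Set ℝ}
    {U : Set E} (hI : IsOpen I) (hU : IsOpen U) {n : WithTop ℕ∞} (hn : 2 ≤ n)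
    (hF : ContDiffOn ℝ n F U) (hγ : ContDiffOn ℝ n γ I) (hmaps : MapsTo γ I U) {s : ℝ}
    (hs : s ∈ I) :
    HasDerivAt (fun s => fderiv ℝ F (γ s) (deriv γ s))
      (fderiv ℝ (fderiv ℝ F) (γ s) (deriv γ s) (deriv γ s) +
        fderiv ℝ F (γ s) (deriv (deriv γ) s)) s := by
  have h1n : 1 ≤ n := le_trans (by norm_num) hn
  have hγd : HasDerivAt γ (deriv γ s) s :=
    ((hγ.contDiffAt (hI.mem_nhds hs)).differentiableAt (zero_lt_one.trans_le h1n).ne').hasDerivAt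
  have hγ' : ContDiffOn ℝ 1 (deriv γ) I := hγ.deriv_of_isOpen hI (by
    calc (1 : WithTop ℕ∞) + 1 = 2 := by norm_num
      _ ≤ n := hn)
  have hγ'd : HasDerivAt (deriv γ) (deriv (deriv γ) s) s :=
    ((hγ'.contDiffAt (hI.mem_nhds hs)).differentiableAt one_ne_zero).hasDerivAt
  have hF' : ContDiffOn ℝ 1 (fderiv ℝ F) U := hF.fderiv_of_isOpen hU (by
    calc (1 : WithTop ℕ∞) + 1 = 2 := by norm_num
      _ ≤ n := hn)
  have hF'd : HasFDerivAt (fderiv ℝ F) (fderiv ℝ (fderiv ℝ F) (γ s)) (γ s) :=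
    ((hF'.contDiffAt (hU.mem_nhds (hmaps hs))).differentiableAt one_ne_zero).hasFDerivAt
  have hc : HasDerivAt (fun s => fderiv ℝ F (γ s)) (fderiv ℝ (fderiv ℝ F) (γ s) (deriv γ s)) s :=
    hF'd.comp_hasDerivAt s hγd
  exact hc.clm_apply hγ'd

/-- `(F ∘ γ)'' = D²F(γ)(γ', γ') + DF(γ)(γ'')` as functions on `I` (`n ≥ 2`). [folklore] -/
theorem deriv_deriv_comp_curve {F : E → G} {γ : ℝ → E} {I : Set ℝ} {U : Set E} (hI : IsOpen I)
    (hU : IsOpen U) {n : WithTop ℕ∞} (hn : 2 ≤ n) (hF : ContDiffOn ℝ n F U)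
    (hγ : ContDiffOn ℝ n γ I) (hmaps : MapsTo γ I U) :
    EqOn (deriv (deriv (F ∘ γ)))
      (fun s => fderiv ℝ (fderiv ℝ F) (γ s) (deriv γ s) (deriv γ s) +
        fderiv ℝ F (γ s) (deriv (deriv γ) s)) I := by
  intro s hs
  have h1n : 1 ≤ n := le_trans (by norm_num) hn
  have hev : deriv (F ∘ γ) =ᶠ[𝓝 s] fun s => fderiv ℝ F (γ s) (deriv γ s) :=
    eventuallyEq_of_mem (hI.mem_nhds hs) (deriv_comp_curve hI hU h1n hF hγ hmaps)
  rw [hev.deriv_eq]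
  exact (hasDerivAt_fderiv_comp_curve_apply_deriv hI hU hn hF hγ hmaps hs).deriv

/-- **Third derivative along a curve** (Faà di Bruno to order three):
`(F ∘ γ)''' = D³F(γ)(γ',γ',γ') + D²F(γ)(γ'',γ') + 2 D²F(γ)(γ',γ'') + DF(γ)(γ''')` on `I`
(`n ≥ 3`). [folklore] -/
theorem deriv_deriv_deriv_comp_curve {F : E → G} {γ : ℝ → E} {I : Set ℝ} {U : Set E}
    (hI : IsOpen I) (hU : IsOpen U) {n : WithTop ℕ∞} (hn : 3 ≤ n) (hF : ContDiffOn ℝ n F U)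
    (hγ : ContDiffOn ℝ n γ I) (hmaps : MapsTo γ I U) :
    EqOn (deriv (deriv (deriv (F ∘ γ))))
      (fun s => fderiv ℝ (fderiv ℝ (fderiv ℝ F)) (γ s) (deriv γ s) (deriv γ s) (deriv γ s) +
        fderiv ℝ (fderiv ℝ F) (γ s) (deriv (deriv γ) s) (deriv γ s) +
        (2 : ℝ) • fderiv ℝ (fderiv ℝ F) (γ s) (deriv γ s) (deriv (deriv γ) s) +
        fderiv ℝ F (γ s) (deriv (deriv (deriv γ)) s)) I := by
  intro s hs
  have h1n : 1 ≤ n := le_trans (by norm_num) hn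
  have h2n : 2 ≤ n := le_trans (by norm_num) hn
  -- derivative data of `γ` up to order three at `s`
  have hγd : HasDerivAt γ (deriv γ s) s :=
    ((hγ.contDiffAt (hI.mem_nhds hs)).differentiableAt (zero_lt_one.trans_le h1n).ne').hasDerivAt
  have hγ' : ContDiffOn ℝ 2 (deriv γ) I := hγ.deriv_of_isOpen hI (by
    calc (2 : WithTop ℕ∞) + 1 = 3 := by norm_num
      _ ≤ n := hn)
  have hγ'd : HasDerivAt (deriv γ) (deriv (deriv γ) s) s :=
    ((hγ'.contDiffAt (hI.mem_nhds hs)).differentiableAt two_ne_zero).hasDerivAt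
  have hγ'' : ContDiffOn ℝ 1 (deriv (deriv γ)) I := hγ'.deriv_of_isOpen hI (by norm_num)
  have hγ''d : HasDerivAt (deriv (deriv γ)) (deriv (deriv (deriv γ)) s) s :=
    ((hγ''.contDiffAt (hI.mem_nhds hs)).differentiableAt one_ne_zero).hasDerivAt
  -- derivative data of `F` up to order three at `γ s`
  have hF' : ContDiffOn ℝ 2 (fderiv ℝ F) U := hF.fderiv_of_isOpen hU (by
    calc (2 : WithTop ℕ∞) + 1 = 3 := by norm_num
      _ ≤ n := hn)
  have hF'd : HasFDerivAt (fderiv ℝ F) (fderiv ℝ (fderiv ℝ F) (γ s)) (γ s) :=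
    ((hF'.contDiffAt (hU.mem_nhds (hmaps hs))).differentiableAt two_ne_zero).hasFDerivAt
  have hF'' : ContDiffOn ℝ 1 (fderiv ℝ (fderiv ℝ F)) U := hF'.fderiv_of_isOpen hU (by norm_num)
  have hF''d : HasFDerivAt (fderiv ℝ (fderiv ℝ F)) (fderiv ℝ (fderiv ℝ (fderiv ℝ F)) (γ s))
      (γ s) :=
    ((hF''.contDiffAt (hU.mem_nhds (hmaps hs))).differentiableAt one_ne_zero).hasFDerivAt
  -- along the curve
  have hc1 : HasDerivAt (fun s => fderiv ℝ F (γ s)) (fderiv ℝ (fderiv ℝ F) (γ s) (deriv γ s)) s :=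
    hF'd.comp_hasDerivAt s hγd
  have hc2 : HasDerivAt (fun s => fderiv ℝ (fderiv ℝ F) (γ s))
      (fderiv ℝ (fderiv ℝ (fderiv ℝ F)) (γ s) (deriv γ s)) s :=
    hF''d.comp_hasDerivAt s hγd
  -- the second derivative, as a function, and its derivative at `s`
  have hev : deriv (deriv (F ∘ γ)) =ᶠ[𝓝 s] fun s =>
      fderiv ℝ (fderiv ℝ F) (γ s) (deriv γ s) (deriv γ s) +
        fderiv ℝ F (γ s) (deriv (deriv γ) s) :=
    eventuallyEq_of_mem (hI.mem_nhds hs) (deriv_deriv_comp_curve hI hU h2n hF hγ hmaps)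
  rw [hev.deriv_eq]
  have hA := (hc2.clm_apply hγ'd).clm_apply hγ'd
  have hB := hc1.clm_apply hγ''d
  have key : deriv (fun s => fderiv ℝ (fderiv ℝ F) (γ s) (deriv γ s) (deriv γ s) +
      fderiv ℝ F (γ s) (deriv (deriv γ) s)) s = _ := (hA.add hB).deriv
  rw [key]
  dsimp only
  simp only [_root_.add_apply, two_smul]
  abel

/-- **Third derivative along a curve, symmetric form**: with `D²F(γ s)` symmetric,
`(F ∘ γ)'''(s) = D³F(γ)(γ',γ',γ') + 3 D²F(γ)(γ'',γ') + DF(γ)(γ''')`. [folklore] -/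
theorem deriv_deriv_deriv_comp_curve_symm {F : E → G} {γ : ℝ → E} {I : Set ℝ} {U : Set E}
    (hI : IsOpen I) (hU : IsOpen U) {n : WithTop ℕ∞} (hn : 3 ≤ n) (hF : ContDiffOn ℝ n F U)
    (hγ : ContDiffOn ℝ n γ I) (hmaps : MapsTo γ I U) {s : ℝ} (hs : s ∈ I)
    (hsymm : ∀ v w, fderiv ℝ (fderiv ℝ F) (γ s) v w = fderiv ℝ (fderiv ℝ F) (γ s) w v) :
    deriv (deriv (deriv (F ∘ γ))) s =
      fderiv ℝ (fderiv ℝ (fderiv ℝ F)) (γ s) (deriv γ s) (deriv γ s) (deriv γ s) +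
        (3 : ℝ) • fderiv ℝ (fderiv ℝ F) (γ s) (deriv (deriv γ) s) (deriv γ s) +
        fderiv ℝ F (γ s) (deriv (deriv (deriv γ)) s) := by
  have h := deriv_deriv_deriv_comp_curve hI hU hn hF hγ hmaps hs
  dsimp only at h
  rw [h, hsymm (deriv γ s) (deriv (deriv γ) s)]
  have h3 : (3 : ℝ) = 1 + 2 := by norm_num
  rw [h3, add_smul, one_smul]
  abel

end

end Literature.Analysis.Calculus
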